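import Literature.Computability.AlgebraicComplexity.BI17SL3InvariantDimensionProofs
import HarnessLib

/-!
# Bürgisser–Ikenmeyer 2017, Ex. 5.5: the table `k_3(0..9)` — PROOFS (kernel certificates)

P. Bürgisser, C. Ikenmeyer, *Fundamental invariants of orbit closures*, J. Algebra **477** (2017)
390–434 = arXiv:1511.02927 [BurgisserIkenmeyer2017], Ex. 5.5 (held text `paper:arxiv-1511.02927`
p0018:L98): "The generic exponent monoid `E'(3) = {0,2,3,4,…}` is generated by `2,3`. Thus `1` is
the only gap. The first function values of `k_3` are given by
`k_3(0..12) = 1, 0, 1, 1, 2, 1, 3, 2, 4, 3, 5, 4, 7`. … `k_3(3) = 1` states the existence and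
uniqueness of Strassen's invariant" (in print a SCHUR computation; `k_3(δ) = g(3×δ, 3×δ, 3×δ)`, the
Kronecker coefficient of three `3 × δ` rectangles = `dim O(⊗³ℂ³)^{SL₃³}_{3δ}`). THEOREMS ONLY; sibling
of the statement file `BI17FundamentalInvariantTensors.lean` (val-lit row BI2017-B), whose named fact
`BI2017_ex_5_5` (this table ∧ `E(3) = {3δ : δ ≠ 1}`) is NOT restated here; its degree-monoid
conjunct is the tree's `BI2017_ex_5_5_degreeMonoid` and its entry `k_3(1) = 0` the tree's
`kronRect_three_one` (`BI17SL3InvariantDimensionProofs.lean`). The discharge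
`BI2017_ex_5_5_holds` is assembled in `BI17Ex55Proofs.lean` from this file and the chunked
certificates for `k_3(10)`, `k_3(11)`, `k_3(12)` (`BI17Ex55KroneckerChunks30.lean`, `…33A/B.lean`,
`…36A–F.lean`).

## Method

Exact values, not only positivity: the tree's verified Murnaghan–Nakayama evaluator gives
`n! · g(λ, μ, ν) = MNEval.kronSum n λ μ ν` (`MNEval.kroneckerCoeff_eq_kronSum_div`,
`Literature/RepresentationTheory/FiniteGroups/SymmetricGroupCharacterEvaluation.lean`), so
`k_3(δ) = v` follows from the closed identity `kronSum (3δ) (δ,δ,δ)³ = v · (3δ)!` checked by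
`decide +kernel` (`Ex55.kronRect_eq_of_kronSum_eq`). For `3`-row shapes the evaluator's state space is
tiny and the cost is governed by the class count `p(3δ)`: `δ ≤ 9` (`S_27`, `3010` classes, under a
minute) fits one `decide`; `δ = 10, 11, 12` do not reliably (kernel memory guard) and are certified
in chunks by the largest cycle length, via the decomposition `Ex55.kronSum_succ_eq_chunks` proved here:
`kronSum (n+1) = kronTerm (n+1) [] + ∑_{p=2}^{n+1} ∑_{ρ : largest part p} kronTerm (n+1) ρ`
(one unfolding of `MNEval.cycleTypesAux`). No new definition, no new named fact; the integers were
produced by an independent script and are CHECKED by the kernel.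

Honest framing: typed-literature bookkeeping for the cell `val-lit` (LADDER-VALIANT V3, a
known-results layer); nothing here bears on VP versus VNP.

## References

* [BurgisserIkenmeyer2017] P. Bürgisser, C. Ikenmeyer, *Fundamental invariants of orbit closures*,
  J. Algebra 477 (2017) 390–434; arXiv:1511.02927, §5 Ex. 5.5 (and eq. (5.2) for `k_m(δ)`).
* [FultonHarrisGTM129] W. Fulton, J. Harris, *Representation Theory*, GTM 129, Exercise 4.51 (the
  character formula for Kronecker coefficients behind `MNEval.kronSum`).
-/

open _root_.Literature.NumberTheory.DiophantineGeometry
open _root_.Literature.RepresentationTheory.FiniteGroups.MNEval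

namespace Literature.Computability.AlgebraicComplexity

namespace Ex55

/-! ### Plumbing: exact values from the evaluator, and the chunk decomposition -/

/-- The sum of a `flatMap` is the sum of the sums (private plumbing). [folklore] -/
private theorem list_sum_flatMap {α M : Type*} [AddMonoid M] (l : List α) (f : α → List M) :
    (l.flatMap f).sum = (l.map fun a => (f a).sum).sum := by
  induction l with
  | nil => simp
  | cons a l ih => rw [List.flatMap_cons, List.sum_append, List.map_cons, List.sum_cons, ih]

/-- **Chunk decomposition of the Kronecker class sum by the largest cycle length**:
`kronSum (n+1) λ μ ν = kronTerm (n+1) λ μ ν [] + ∑_{p=2}^{n+1} ∑_{t} kronTerm (n+1) λ μ ν (p :: t)`,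
`t` over `cycleTypesAux n (n+1-p) p` (the decreasing tails with parts in `[2, p]` and sum
`≤ n+1-p`) — one unfolding of `MNEval.cycleTypes (n+1) = MNEval.cycleTypesAux (n+1) (n+1) (n+1)`.
[cite: FultonHarrisGTM129, Exercise 4.51] -/
theorem kronSum_succ_eq_chunks (n : ℕ) (L M K : List ℕ) :
    kronSum (n + 1) L M K = kronTerm (n + 1) L M K [] +
      ((List.range' 2 n).map fun p =>
        (((cycleTypesAux n (n + 1 - p) p).map fun l => kronTerm (n + 1) L M K (p :: l))).sum).sum := by
  rw [kronSum, cycleTypes, cycleTypesAux]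
  simp only [min_self, Nat.add_sub_cancel, List.map_cons, List.sum_cons, List.map_flatMap,
    list_sum_flatMap, List.map_map, Function.comp_def]

/-- **Exact rectangular Kronecker coefficients from the evaluator**: if
`kronSum (mδ) (δ,…,δ)³ = v · (mδ)!` then `k_m(δ) = v` (`δ ≠ 0`; `n! g = kronSum` and the sorted parts
of the rectangle `m × δ` are `m` copies of `δ`). [cite: BurgisserIkenmeyer2017, §5 eq. (5.2)] -/
theorem kronRect_eq_of_kronSum_eq {m δ : ℕ} (v : ℕ) (hδ : δ ≠ 0)
    (h : kronSum (m * δ) (List.replicate m δ) (List.replicate m δ) (List.replicate m δ) =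
      (v : ℤ) * ((m * δ).factorial : ℕ)) :
    kronRect ℂ m δ = v := by
  have h1 := kroneckerCoeff_eq_kronSum_div (Nat.Partition.rectangle m δ)
    (Nat.Partition.rectangle m δ) (Nat.Partition.rectangle m δ)
  rw [Nat.Partition.sortedParts_rectangle m δ hδ, h,
    Int.mul_ediv_cancel _ (by exact_mod_cast Nat.factorial_ne_zero _)] at h1
  unfold kronRect
  exact_mod_cast h1

/-- The rectangle `m × 0` is the empty partition: no sorted parts (private plumbing). [folklore] -/
private theorem sortedParts_rectangle_zero (m : ℕ) : (Nat.Partition.rectangle m 0).sortedParts = [] := by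
  rw [Nat.Partition.sortedParts, Nat.Partition.parts_rectangle]
  have h : (Multiset.replicate m 0).filter (· ≠ 0) = 0 :=
    Multiset.filter_eq_nil.2 fun a ha => by simp [Multiset.eq_of_mem_replicate ha]
  rw [h, Multiset.sort_zero]

end Ex55

open Ex55

/-! ### The table `k_3(0), k_3(2), …, k_3(9)` (with `k_3(1) = 0` = `kronRect_three_one`) -/

section Table

/-- **`k_3(0) = 1`** (Ex. 5.5 table; the empty partitions). [cite: BurgisserIkenmeyer2017, Ex. 5.5] -/
theorem kronRect_three_zero : kronRect ℂ 3 0 = 1 := by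
  have h1 := kroneckerCoeff_eq_kronSum_div (Nat.Partition.rectangle 3 0)
    (Nat.Partition.rectangle 3 0) (Nat.Partition.rectangle 3 0)
  rw [sortedParts_rectangle_zero] at h1
  have h2 : kronSum (3 * 0) [] [] [] / ((3 * 0).factorial : ℕ) = (1 : ℤ) := by decide
  rw [h2] at h1
  unfold kronRect
  exact_mod_cast h1

/-- **`k_3(2) = 1`** (Ex. 5.5 table; `S_6`). [cite: BurgisserIkenmeyer2017, Ex. 5.5] -/
theorem kronRect_three_two : kronRect ℂ 3 2 = 1 :=
  kronRect_eq_of_kronSum_eq 1 (by norm_num) (by decide +kernel)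

/-- **`k_3(3) = 1`** (Ex. 5.5 table: "the existence and uniqueness of Strassen's invariant"; `S_9`).
[cite: BurgisserIkenmeyer2017, Ex. 5.5] -/
theorem kronRect_three_three : kronRect ℂ 3 3 = 1 :=
  kronRect_eq_of_kronSum_eq 1 (by norm_num) (by decide +kernel)

/-- **`k_3(4) = 2`** (Ex. 5.5 table; `S_12`). [cite: BurgisserIkenmeyer2017, Ex. 5.5] -/
theorem kronRect_three_four : kronRect ℂ 3 4 = 2 :=
  kronRect_eq_of_kronSum_eq 2 (by norm_num) (by decide +kernel)

/-- **`k_3(5) = 1`** (Ex. 5.5 table; `S_15`). [cite: BurgisserIkenmeyer2017, Ex. 5.5] -/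
theorem kronRect_three_five : kronRect ℂ 3 5 = 1 :=
  kronRect_eq_of_kronSum_eq 1 (by norm_num) (by decide +kernel)

set_option maxHeartbeats 100000000 in
set_option maxRecDepth 100000 in
/-- **`k_3(6) = 3`** (Ex. 5.5 table; `S_18`). [cite: BurgisserIkenmeyer2017, Ex. 5.5] -/
theorem kronRect_three_six : kronRect ℂ 3 6 = 3 :=
  kronRect_eq_of_kronSum_eq 3 (by norm_num) (by decide +kernel)

set_option maxHeartbeats 100000000 in
set_option maxRecDepth 100000 in
/-- **`k_3(7) = 2`** (Ex. 5.5 table; `S_21`). [cite: BurgisserIkenmeyer2017, Ex. 5.5] -/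
theorem kronRect_three_seven : kronRect ℂ 3 7 = 2 :=
  kronRect_eq_of_kronSum_eq 2 (by norm_num) (by decide +kernel)

set_option maxHeartbeats 100000000 in
set_option maxRecDepth 100000 in
/-- **`k_3(8) = 4`** (Ex. 5.5 table; `S_24`, ≈ 20 s of kernel time). [cite: BurgisserIkenmeyer2017, Ex. 5.5] -/
theorem kronRect_three_eight : kronRect ℂ 3 8 = 4 :=
  kronRect_eq_of_kronSum_eq 4 (by norm_num) (by decide +kernel)

set_option maxHeartbeats 100000000 in
set_option maxRecDepth 100000 in
/-- **`k_3(9) = 3`** (Ex. 5.5 table; `S_27`, ≈ 50 s of kernel time). [cite: BurgisserIkenmeyer2017, Ex. 5.5] -/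
theorem kronRect_three_nine : kronRect ℂ 3 9 = 3 :=
  kronRect_eq_of_kronSum_eq 3 (by norm_num) (by decide +kernel)

end Table

end Literature.Computability.AlgebraicComplexity
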